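import Mathlib
import Literature.NumberTheory.LFunctions.Zhang2022.Section16Eq1610
import Literature.NumberTheory.LFunctions.Zhang2022.Section16AEq1610Glue
import HarnessLib

/-!
# Zhang (2022), §16 (16.10) on the support of `b₁` (`dl < 2PT⁻⁸`) and the closing of (16.12)

Topic `Literature/NumberTheory/LFunctions/Zhang2022` (Landau–Siegel audit tree; verdict-neutral).
Y. Zhang, *Discrete mean estimates and the Landau–Siegel zero*, arXiv:2211.02515v1 (2022)
[Zhang2022LandauSiegel] — **an unrefereed manuscript under adjudication**; nothing here asserts its
Theorems 1–2. DAG node `Z22:(16.10)` [Z22 p.92, tex L4550–L4556], companion of `Section16Eq1610`: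
the same contour shift, run on the WIDE range actually summed in (16.12) — the support of `b₁`,
`dl < 2T²P^{1/2}max(P₂, P₃) = 2PT⁻⁸` (for `𝓛 ≥ 64`, `P₃ = P^{0.498} ≤ P₂ = P^{1/2}T⁻¹⁰`), where the
manuscript's "`P₄/d > T`" weakens to `P₄/d ≥ T⁶/2`, still ample: the left-line saving is
`(d/P₄)^{η} ≤ 2T^{−6η} ≤ 2e^{−(3c/4)𝓛^{1/10}}`.

* `integral_u023_sub_residues_le_core` — the estimate under the two range facts the contour uses,
  `d·T⁶ ≤ 2P₄` and `d ≤ 2P`;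
* `integral_u023_sub_residues_le_wide` — the hypothesis `hI` of the tree's glue
  `Typed.Section16A.eq16_10W_of_integral_bound_pow` verbatim with `k = 2000`;
* `eq16_12_of_eq16_5P` — hence **(16.12)** (`Typed.Section16A.Eq16_12 c′`) from `Eq16_5P c′` (node
  (16.5)), `Step16_u021an c′`, `Step16_u022 c′` (nodes §16.u021an/§16.u022), by the tree's
  `Typed.Section16A.eq16_12_of_eq16_5P_of_integral_bound_pow`.

As in `Section16Eq1610`, the error is `O(∏_{q∣dl}(1 + cq^{−9/10})·𝓛⁻²⁰⁰⁰)`, not the printed `O(ε₁)`: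
the residue at the exceptional-zero pole `ρ̃ − 1` is only polynomially small under (A).

## References

* Y. Zhang, arXiv:2211.02515v1 (2022), §16 (16.9)–(16.12) p.92; §15 (15.15) p.85.
  [cite: Zhang2022LandauSiegel, §16 (16.10) p.92]
* H. L. Montgomery, R. C. Vaughan, *Multiplicative Number Theory I*, CUP 2007, §6.2, Thm 11.4.
  [cite: MontgomeryVaughan2007, §6.2]
-/

noncomputable section

open Complex Real Filter Topology Set MeasureTheory
open Literature.NumberTheory.LFunctions.Zhang2022
open Literature.NumberTheory.LFunctions.Zhang2022.Skeleton
open Literature.NumberTheory.LFunctions.Zhang2022.Typed.Section16A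

namespace Literature.NumberTheory.LFunctions.Zhang2022.Eq1610

section Range

variable {D : ℕ}

/-- **The support of `b₁` lies in `dl < 2PT⁻⁸`.** For `𝓛 ≥ 64`, `P₃ = P^{0.498} ≤ P₂ = P^{1/2}T⁻¹⁰`
(`10𝓛^{1.1} ≤ 0.002𝓛⁹`), so `d ≤ x < 2T²P^{1/2}max(P₂,P₃) = 2PT⁻⁸` gives `d ≤ 2P` and
`d·T⁶ ≤ 2PT⁻² ≤ 2P₄` (`t₀ ≥ 1`). [cite: Zhang2022LandauSiegel, §16 (16.12) p.92] -/
theorem range_facts_of_lt_support (hL : 64 ≤ ell D) {d : ℕ} {x : ℝ} (hdx : (d : ℝ) ≤ x)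
    (hx : x < 2 * bigT D ^ 2 * (bigP D ^ (1 / 2 : ℝ) * max (Skeleton.P2 D) (P3 D))) :
    (d : ℝ) * bigT D ^ 6 ≤ 2 * P4 D ∧ (d : ℝ) ≤ 2 * bigP D := by
  have hℓ : 0 < ell D := by linarith
  have hℓ1 : 1 ≤ ell D := by linarith
  have hP0 : 0 < bigP D := Real.exp_pos _
  have hT0 : 0 < bigT D := Real.exp_pos _
  have hT1 : 1 ≤ bigT D := Real.one_le_exp (Real.rpow_nonneg hℓ.le _)
  have ht0 : 1 ≤ t0 D := by rw [t0]; exact one_le_pow₀ hℓ1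
  -- `P₃ ≤ P₂`
  have h32 : P3 D ≤ Skeleton.P2 D := by
    rw [P3, Skeleton.P2, le_div_iff₀ (pow_pos hT0 10)]
    have hP3 : bigP D ^ (0.498 : ℝ) = Real.exp (0.498 * ell D ^ 9) := by
      rw [bigP, ← Real.exp_mul]; ring_nf
    have hP5 : bigP D ^ (0.5 : ℝ) = Real.exp (0.5 * ell D ^ 9) := by
      rw [bigP, ← Real.exp_mul]; ring_nf
    have hT10 : bigT D ^ 10 = Real.exp (10 * ell D ^ (1.1 : ℝ)) := by
      rw [bigT, ← Real.exp_nat_mul]; push_cast; ring_nf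
    rw [hP3, hP5, hT10, ← Real.exp_add]
    refine Real.exp_le_exp.mpr ?_
    have h11 : ell D ^ (1.1 : ℝ) ≤ ell D ^ (2 : ℝ) :=
      Real.rpow_le_rpow_of_exponent_le hℓ1 (by norm_num)
    have h2 : ell D ^ (2 : ℝ) = ell D ^ 2 := by norm_cast
    rw [h2] at h11
    have h7 : (64 : ℝ) ^ 7 ≤ ell D ^ 7 := pow_le_pow_left₀ (by norm_num) hL 7
    have h9 : ell D ^ 9 = ell D ^ 2 * ell D ^ 7 := by ring
    have hsq : 0 ≤ ell D ^ 2 := sq_nonneg _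
    have h3 : 5000 * ell D ^ 2 ≤ ell D ^ 2 * ell D ^ 7 := by nlinarith only [h7, hsq]
    rw [h9]; linarith only [h11, h3]
  have hmax : max (Skeleton.P2 D) (P3 D) = Skeleton.P2 D := max_eq_left h32
  -- `x < 2PT⁻⁸`
  have hx' : x < 2 * bigP D / bigT D ^ 8 := by
    rw [hmax, Skeleton.P2] at hx
    have hPP : bigP D ^ (1 / 2 : ℝ) * bigP D ^ (0.5 : ℝ) = bigP D := by
      rw [← Real.rpow_add hP0]; norm_num
    have hrw : 2 * bigT D ^ 2 * (bigP D ^ (1 / 2 : ℝ) * (bigP D ^ (0.5 : ℝ) / bigT D ^ 10)) =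
        2 * bigP D / bigT D ^ 8 := by
      have hT2 : bigT D ^ 2 ≠ 0 := pow_ne_zero 2 hT0.ne'
      have hT8 : bigT D ^ 8 ≠ 0 := pow_ne_zero 8 hT0.ne'
      calc 2 * bigT D ^ 2 * (bigP D ^ (1 / 2 : ℝ) * (bigP D ^ (0.5 : ℝ) / bigT D ^ 10))
          = 2 * (bigP D ^ (1 / 2 : ℝ) * bigP D ^ (0.5 : ℝ)) * (bigT D ^ 2 / (bigT D ^ 2 * bigT D ^ 8)) := by
            ring
        _ = 2 * bigP D / bigT D ^ 8 := by
            rw [hPP, mul_comm (bigT D ^ 2) (bigT D ^ 8), div_mul_cancel_right₀ hT2 (bigT D ^ 8),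
              div_eq_mul_inv]
    rwa [hrw] at hx
  have hd : (d : ℝ) ≤ 2 * bigP D / bigT D ^ 8 := by linarith only [hdx, hx']
  have hT8 : 0 < bigT D ^ 8 := pow_pos hT0 8
  constructor
  · -- `d·T⁶ ≤ 2PT⁻² ≤ 2P₄`
    have h1 : (d : ℝ) * bigT D ^ 6 ≤ 2 * bigP D / bigT D ^ 2 := by
      have := mul_le_mul_of_nonneg_right hd (pow_pos hT0 6).le
      refine this.trans (le_of_eq ?_)
      rw [div_mul_eq_mul_div, div_eq_div_iff (pow_ne_zero 8 hT0.ne') (pow_ne_zero 2 hT0.ne')]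
      ring
    refine h1.trans ?_
    rw [P4]
    have h2 : 2 * bigP D / bigT D ^ 2 = 2 * (bigP D / bigT D ^ 2 * 1) := by ring
    rw [h2]
    gcongr
  · refine hd.trans ?_
    rw [div_le_iff₀ hT8]
    have : 1 ≤ bigT D ^ 8 := one_le_pow₀ hT1
    nlinarith only [this, hP0]

end Range

section Main

variable (c' : ℝ)

/-- **(16.10) at the integral level under the two range facts the contour uses** (`d·T⁶ ≤ 2P₄`,
`d ≤ 2P`): for all large `D`, every real primitive `χ (mod D)` with (A), all such `d, l ≥ 1`,
`‖(2πi)⁻¹∫_{(1)}[integrand of §16.u023] − Σ_{j=1,2} ℛ₂ⱼ d^{βⱼ} ℳ₂(d,l;1−βⱼ)‖ ≤ C∏_{q∣dl}(1 + c/q^{9/10})𝓛⁻²⁰⁰⁰`,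
from §16.u021an and §16.u022 as hypotheses BY NAME. Same proof as
`integral_u023_sub_residues_le` with the left-line saving `(d/P₄)^{η} ≤ 2e^{−6η𝓛^{1.1}}`.
[cite: Zhang2022LandauSiegel, §16 (16.10)–(16.11) p.92] [cite: MontgomeryVaughan2007, §6.2] -/
theorem integral_u023_sub_residues_le_core (h21 : Step16_u021an c') (h22 : Step16_u022 c') :
    ∃ c C : ℝ, ForAllLarge fun D _ χ => AssumptionA D χ →
      ∀ d l : ℕ, 1 ≤ d → 1 ≤ l → (d : ℝ) * bigT D ^ 6 ≤ 2 * P4 D → (d : ℝ) ≤ 2 * bigP D →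
        ‖(1 / (2 * π) : ℂ) * (∫ t : ℝ, integrand16_u023 c' χ d l (1 + t * I)) -
            ∑ j ∈ ({1, 2} : Finset ℕ),
              calR2 c' χ j * (d : ℂ) ^ betaJ c' D j * calM2 c' χ d l (1 - betaJ c' D j)‖ ≤
          C * (∏ q ∈ (d * l).primeFactors, (1 + c / (q : ℝ) ^ (9 / 10 : ℝ))) * (ell D ^ 2000)⁻¹ := by
  -- the packages
  obtain ⟨c₂₂, C₂₂, D₂₂, h22'⟩ := h22
  obtain ⟨D₂₁, h21'⟩ := h21
  obtain ⟨cL, hcL, hcL4, CL, hCL, K₅, hK₅, DE, hE⟩ := Lemma84.exceptional_package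
  obtain ⟨cbar, hcbar, -, Cζ, hCζ, hζ⟩ := ZetaClassicalRegion.exists_zeroFreeRegion_bounds
  obtain ⟨rζ, hrζ, Kζ, -, hζ1⟩ := ResidueValues.zeta_near_one
  obtain ⟨CLβ, -, DLβ, hLβ⟩ := ResidueValues.L_one_sub_beta_bounds
  obtain ⟨Lb, -, hbudget⟩ := gauss_budget_le_one
  obtain ⟨Lg, -, hG⟩ := rpow_le_exp_mul_rpow (k := 2020) (κ := 3 * cL / 4) (ε := 1 / 10)
    (by norm_num) (by positivity) (by norm_num)
  have hκ₂0 : 0 < 8 * cbar / cL := by positivity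
  -- the threshold
  obtain ⟨L₀, hL₀64, hL₀b, hL₀g, hL₀κ, hL₀17, hL₀K1, hL₀K2, hL₀K3⟩ : ∃ L₀ : ℝ, 64 ≤ L₀ ∧ Lb ≤ L₀ ∧
      Lg ≤ L₀ ∧ max 4 ((41 / (8 * cbar / cL)) ^ 2) ≤ L₀ ∧ 1700 ≤ L₀ ∧ 16 * K₅ / cL + 1 ≤ L₀ ∧
      K₅ / rζ + 1 ≤ L₀ ∧ K₅ + 1 ≤ L₀ :=
    ⟨64 + |Lb| + |Lg| + max 4 ((41 / (8 * cbar / cL)) ^ 2) + 1700 + (16 * K₅ / cL + 1) +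
        (K₅ / rζ + 1) + (K₅ + 1), by
      have h1 : 0 ≤ max 4 ((41 / (8 * cbar / cL)) ^ 2) := le_trans (by norm_num) (le_max_left _ _)
      have h2 : 0 ≤ 16 * K₅ / cL + 1 := by positivity
      have h3 : 0 ≤ K₅ / rζ + 1 := by positivity
      have h4 : 0 ≤ K₅ + 1 := by positivity
      have h5 := le_abs_self Lb
      have h6 := le_abs_self Lg
      have h7 := abs_nonneg Lb
      have h8 := abs_nonneg Lg
      refine ⟨by linarith, by linarith, by linarith, by linarith, by linarith, by linarith,
        by linarith, by linarith⟩⟩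
  refine ⟨c₂₂, C₂₂ * (48 / π +
      1 / (2 * π) * ((8 / cL + Cζ) * Cζ * (2 * (CL + 1)) * (1 + 16 / cL) * (24 / cL) * 8) +
      72 * (1 + Cζ) * Cζ * (CL + 1) / π + 2 * (CL + 1) * (2 / π + Cζ) * (2 * K₅) * 3 * (3 / π)),
    max (max ⌈Real.exp 3⌉₊ ⌈Real.exp (14 * |c'| * π)⌉₊)
      (max (max D₂₁ D₂₂) (max (max DE DLβ) ⌈Real.exp L₀⌉₊)),
    fun D _ χ hD hq hp hA_ d l hd1 hl1 hdT hd2P => ?_⟩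
  -- unpack the threshold
  have hDth : max ⌈Real.exp 3⌉₊ ⌈Real.exp (14 * |c'| * π)⌉₊ ≤ D := le_trans (le_max_left _ _) hD
  have hD' : max (max D₂₁ D₂₂) (max (max DE DLβ) ⌈Real.exp L₀⌉₊) ≤ D := le_trans (le_max_right _ _) hD
  have hD₂₁ : D₂₁ ≤ D := le_trans (le_trans (le_max_left _ _) (le_max_left _ _)) hD'
  have hD₂₂ : D₂₂ ≤ D := le_trans (le_trans (le_max_right _ _) (le_max_left _ _)) hD'
  have hDE : DE ≤ D := le_trans (le_trans (le_trans (le_max_left _ _) (le_max_left _ _)) (le_max_right _ _)) hD'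
  have hDLβ : DLβ ≤ D :=
    le_trans (le_trans (le_trans (le_max_right _ _) (le_max_left _ _)) (le_max_right _ _)) hD'
  have hDL₀ : ⌈Real.exp L₀⌉₊ ≤ D := le_trans (le_trans (le_max_right _ _) (le_max_right _ _)) hD'
  obtain ⟨hL3, he⟩ := ResidueValues.thresholds c' hDth
  have hLL₀ : L₀ ≤ ell D := by
    have h : Real.exp L₀ ≤ D := le_trans (Nat.le_ceil _) (by exact_mod_cast hDL₀)
    exact (Real.le_log_iff_exp_le (lt_of_lt_of_le (Real.exp_pos _) h)).mpr h
  set L : ℝ := ell D with hLdef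
  clear_value L
  have hL3' : 3 ≤ ell D := by rw [← hLdef]; exact hL3
  have he' : |c' * alpha D * ell D| ≤ 1 / 14 := by rw [← hLdef]; exact he
  have hL64 : 64 ≤ L := le_trans hL₀64 hLL₀
  have hLb : Lb ≤ L := le_trans hL₀b hLL₀
  have hLg : Lg ≤ L := le_trans hL₀g hLL₀
  have hLκ₂ : max 4 ((41 / (8 * cbar / cL)) ^ 2) ≤ L := le_trans hL₀κ hLL₀
  have hL1700 : 1700 ≤ L := le_trans hL₀17 hLL₀
  have hLK1 : 16 * K₅ / cL + 1 ≤ L := le_trans hL₀K1 hLL₀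
  have hLK2 : K₅ / rζ + 1 ≤ L := le_trans hL₀K2 hLL₀
  have hLK3 : K₅ + 1 ≤ L := le_trans hL₀K3 hLL₀
  have hL1 : 1 ≤ L := by linarith only [hL64]
  have hL0 : 0 < L := by linarith only [hL64]
  -- the shifts and `P₄`
  obtain ⟨hb1l, hb1u, hb2l, hb2u, hb12, hb1', hb2', hβ1n, hα, hαeq⟩ := b_sizes c' hL3' he'
  rw [← hLdef] at hαeq
  obtain ⟨hP1, hP4le⟩ := P4_sizes hL3'
  rw [← hLdef] at hP4le
  have hb1 : 0 < b1 c' D := by linarith only [hb1l, hα]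
  have hb2 : 0 < b2 c' D := by linarith only [hb2l, hα]
  have hb1π : π / L ^ 9 / 2 ≤ b1 c' D := by rw [← hαeq]; exact hb1l
  have hb2π : π / L ^ 9 ≤ b2 c' D := by rw [← hαeq]; exact hb2l
  -- the character
  have hχ1 : χ ≠ 1 := by
    have hD1 : D ≠ 1 := by rintro rfl; rw [hLdef] at hL3; norm_num [ell] at hL3
    exact GammaFactor.ne_one_of_isPrimitive hp hD1
  have hd : d ≠ 0 := by omega
  -- the `ℳ₂` package
  have hM_diff : DifferentiableOn ℂ (calM2 c' χ d l) {s : ℂ | 9 / 10 < s.re} :=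
    h21' D χ hD₂₁ hq hp d l hd1 hl1
  obtain ⟨W, hW⟩ : ∃ W : ℝ, W = ∏ q ∈ (d * l).primeFactors, (1 + c₂₂ / (q : ℝ) ^ (9 / 10 : ℝ)) :=
    ⟨_, rfl⟩
  obtain ⟨KM, hKM⟩ : ∃ KM : ℝ, KM = C₂₂ * W := ⟨_, rfl⟩
  have hM_bd : ∀ w : ℂ, 9 / 10 < w.re → ‖calM2 c' χ d l w‖ ≤ KM := fun w hw => by
    rw [hKM, hW]; exact h22' D χ hD₂₂ hq hp d l hd1 hl1 w hw
  have hKM0 : 0 ≤ KM := le_trans (norm_nonneg _) (hM_bd 2 (by norm_num))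
  -- the parameters `H`, `ℒ₁`, `η`, `B_ζ`, `M_inv`
  obtain ⟨H, hH⟩ : ∃ H : ℝ, H = L ^ 20 := ⟨_, rfl⟩
  have hH2 : 2 ≤ H := by
    have : L ≤ L ^ 20 := le_self_pow₀ hL1 (by norm_num)
    rw [hH]; linarith only [this, hL64]
  have hH1 : 1 ≤ H := by linarith only [hH2]
  obtain ⟨ℒ₁, hℒ₁⟩ : ∃ ℒ₁ : ℝ, ℒ₁ = L + Real.log (H + 8) := ⟨_, rfl⟩
  have hlogH8 : 0 ≤ Real.log (H + 8) := Real.log_nonneg (by linarith only [hH1])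
  have hℒ₁L : L ≤ ℒ₁ := by rw [hℒ₁]; linarith only [hlogH8]
  have hlogH8L : Real.log (H + 8) ≤ L := by
    have h := log_pow_twenty_add_le (κ := 1) one_pos (L := L)
      (max_le (by linarith only [hL64]) (by norm_num; linarith only [hL1700]))
    rw [hH]; linarith only [h]
  have hℒ₁2L : ℒ₁ ≤ 2 * L := by rw [hℒ₁]; linarith only [hlogH8L]
  have hℒ₁0 : 0 < ℒ₁ := by linarith only [hℒ₁L, hL0]
  obtain ⟨η, hη⟩ : ∃ η : ℝ, η = cL / (4 * ℒ₁) := ⟨_, rfl⟩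
  have hη0 : 0 < η := by rw [hη]; positivity
  have hηup : η ≤ cL / (4 * L) := by
    rw [hη]; exact div_le_div_of_nonneg_left hcL.le (by positivity) (by linarith only [hℒ₁L])
  have hηlow : cL / (8 * L) ≤ η := by
    rw [hη]; exact div_le_div_of_nonneg_left hcL.le (by positivity) (by linarith only [hℒ₁2L])
  have hη20 : η ≤ 1 / 20 := by
    refine hηup.trans ?_
    rw [div_le_iff₀ (by positivity)]; linarith only [hcL4, hL64]
  have hη1 : η ≤ 1 := by linarith only [hη20]
  obtain ⟨Bζ, hBζ⟩ : ∃ Bζ : ℝ, Bζ = Cζ * Real.log (H + 5) := ⟨_, rfl⟩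
  have hlogH5 : 0 ≤ Real.log (H + 5) := Real.log_nonneg (by linarith only [hH1])
  have hBζ0 : 0 ≤ Bζ := by rw [hBζ]; positivity
  have hlogH5L : Real.log (H + 5) ≤ L := by
    have : Real.log (H + 5) ≤ Real.log (H + 8) :=
      Real.log_le_log (by linarith only [hH1]) (by linarith only [hH1])
    linarith only [this, hlogH8L]
  have hBζL : Bζ ≤ Cζ * L := by rw [hBζ]; exact mul_le_mul_of_nonneg_left hlogH5L hCζ.le
  obtain ⟨Minv, hMinv⟩ : ∃ Minv : ℝ, Minv = (CL + 1) * ℒ₁ := ⟨_, rfl⟩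
  have hMinv0 : 0 < Minv := by rw [hMinv]; positivity
  have hMinvL : Minv ≤ 2 * (CL + 1) * L := by
    rw [hMinv]
    have := mul_le_mul_of_nonneg_left hℒ₁2L (by positivity : (0 : ℝ) ≤ CL + 1)
    linarith only [this]
  -- the `ζ` package in the region `Re w ≥ 1 − 2η`, `|Im w| ≤ H + 2`
  have h2η : 2 * η ≤ 4 * cbar / Real.log (H + 5) := by
    have hlog8 : Real.log (L ^ 20 + 8) ≤ 8 * cbar / cL * L := log_pow_twenty_add_le hκ₂0 hLκ₂
    have hlog5 : Real.log (H + 5) ≤ 8 * cbar / cL * L := by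
      have : Real.log (H + 5) ≤ Real.log (L ^ 20 + 8) :=
        Real.log_le_log (by linarith only [hH1]) (by rw [hH]; linarith only [hH1])
      linarith only [this, hlog8]
    have hlog5pos : 0 < Real.log (H + 5) := Real.log_pos (by linarith only [hH1])
    calc 2 * η ≤ 2 * (cL / (4 * L)) := by linarith only [hηup]
      _ = 4 * cbar / (8 * cbar / cL * L) := by field_simp; ring
      _ ≤ 4 * cbar / Real.log (H + 5) :=
          div_le_div_of_nonneg_left (by positivity) hlog5pos hlog5
  have hζpk := zeta_package_of hcbar hCζ hζ hBζ h2η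
  -- the exceptional zero and the `L` package
  have hA' : ‖χ.LFunction 1‖ < (Real.log D ^ 2022)⁻¹ := by rw [← one_div]; exact hA_
  obtain ⟨ρt, hρ1, hρK, hLρ, hL'ρ, hLreg⟩ := hE D χ hDE hχ1 hA'
  have hLD : Real.log D = L := by rw [hLdef]; rfl
  have hρK' : 1 - ρt ≤ K₅ * (L ^ 2022)⁻¹ := by rw [← hLD]; exact hρK
  have hL2022 : L ≤ L ^ 2022 := le_self_pow₀ hL1 (by norm_num)
  have hKL : K₅ * (L ^ 2022)⁻¹ ≤ K₅ / L := by
    rw [div_eq_mul_inv]; exact mul_le_mul_of_nonneg_left (inv_anti₀ hL0 hL2022) hK₅.le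
  have hKL1 : K₅ / L ≤ 1 := by rw [div_le_one hL0]; linarith only [hLK3]
  have hρ0 : 0 ≤ ρt := by linarith only [hρK', hKL, hKL1]
  have hρη : 1 - η / 2 ≤ ρt := by
    have h1 : K₅ * (L ^ 2022)⁻¹ ≤ cL / (16 * L) := by
      have hL2021 : 16 * K₅ / cL ≤ L ^ 2021 := by
        have : L ≤ L ^ 2021 := le_self_pow₀ hL1 (by norm_num)
        linarith only [this, hLK1]
      rw [div_le_iff₀ hcL] at hL2021
      have hpow : L ^ 2022 = L * L ^ 2021 := by ring
      rw [← div_eq_mul_inv, div_le_div_iff₀ (by positivity) (by positivity), hpow]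
      have h16 : K₅ * (16 * L) = (16 * K₅) * L := by ring
      have hcc : cL * (L * L ^ 2021) = (L ^ 2021 * cL) * L := by ring
      rw [h16, hcc]
      exact mul_le_mul_of_nonneg_right hL2021 hL0.le
    have h2 : cL / (16 * L) ≤ η / 2 := by
      have : cL / (16 * L) = cL / (8 * L) / 2 := by ring
      rw [this]; linarith only [hηlow]
    linarith only [hρK', h1, h2]
  have hLpk := L_package_of hcL hCL hLreg hLD hL0 hH1 hℒ₁ hη hMinv
  -- `ζ` next to `1` at `ρ̃`
  have hζρ : ‖((ρt : ℂ) - 1) * riemannZeta ρt - 1‖ ≤ 1 / 2 := by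
    have hρne : (ρt : ℂ) ≠ 1 := by
      intro h
      have := congrArg Complex.re h
      simp only [Complex.ofReal_re, Complex.one_re] at this
      linarith only [this, hρ1]
    have hdist : ‖(ρt : ℂ) - 1‖ < rζ := by
      rw [← Complex.ofReal_one, ← Complex.ofReal_sub, Complex.norm_real, Real.norm_eq_abs,
        abs_of_nonpos (by linarith only [hρ1])]
      have hLr : K₅ / rζ < L := by linarith only [hLK2]
      rw [div_lt_iff₀ hrζ] at hLr
      have : K₅ / L < rζ := by rw [div_lt_iff₀ hL0]; linarith only [hLr]
      linarith only [this, hρK', hKL]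
    exact (hζ1 (ρt : ℂ) hρne hdist).2.2
  -- `L(1 − βⱼ, χ) ≠ 0`
  have hLβ' := hLβ D χ hDLβ hq hp hA_
  have hL1ne : χ.LFunction (1 - beta1 c' D) ≠ 0 :=
    (hLβ' (beta1 c' D) (ResidueValues.norm_beta_ge c' hL3' he').1
      ((ResidueValues.norm_beta1_le c' hL3' he').trans (by linarith only [hα]))).1
  have hL2ne : χ.LFunction (1 - beta2 c' D) ≠ 0 :=
    (hLβ' (beta2 c' D) (ResidueValues.norm_beta_ge c' hL3' he').2.1
      (ResidueValues.norm_beta2_le c' hL3' he')).1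
  -- `d ≤ 2P`, `d^{1−ρ̃} ≤ e`, `(d/P₄)^η ≤ 2e^{−6η𝓛^{1.1}}`
  have hdP : (d : ℝ) ≤ 2 * Real.exp (L ^ 9) := by
    have h2 : bigP D = Real.exp (L ^ 9) := by rw [bigP, hLdef]
    rw [← h2]; exact hd2P
  have hd1r : (1 : ℝ) ≤ d := by exact_mod_cast hd1
  have hE5 : (d : ℝ) ^ (1 - ρt) ≤ Real.exp 1 := by
    rw [Real.rpow_def_of_pos (by positivity)]
    refine Real.exp_le_exp.mpr ?_
    have hL9 : 1 ≤ L ^ 9 := one_le_pow₀ hL1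
    have hlogd : Real.log d ≤ 2 * L ^ 9 := by
      have h := Real.log_le_log (by positivity) hdP
      rw [Real.log_mul (by norm_num) (Real.exp_pos _).ne', Real.log_exp] at h
      have hlog2 : Real.log 2 ≤ 1 := by
        rw [Real.log_le_iff_le_exp (by norm_num)]
        linarith only [Real.add_one_le_exp (1 : ℝ)]
      linarith only [h, hlog2, hL9]
    have hlogd0 : 0 ≤ Real.log d := Real.log_nonneg hd1r
    have h9 : K₅ * (L ^ 2022)⁻¹ * (2 * L ^ 9) ≤ 1 := by
      have hL2013 : 2 * K₅ ≤ L ^ 2013 := by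
        have h1 : L * L ≤ L ^ 2013 := by
          rw [← sq]; exact pow_le_pow_right₀ hL1 (by norm_num)
        have h2 : 64 * L ≤ L * L := mul_le_mul_of_nonneg_right hL64 hL0.le
        linarith only [h1, h2, hLK3, hL0.le]
      have hpow : L ^ 2022 = L ^ 2013 * L ^ 9 := by ring
      rw [hpow, mul_inv]
      calc K₅ * ((L ^ 2013)⁻¹ * (L ^ 9)⁻¹) * (2 * L ^ 9)
          = 2 * K₅ / L ^ 2013 * ((L ^ 9)⁻¹ * L ^ 9) := by ring
        _ = 2 * K₅ / L ^ 2013 := by rw [inv_mul_cancel₀ (pow_ne_zero 9 hL0.ne'), mul_one]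
        _ ≤ 1 := by rw [div_le_one (by positivity)]; exact hL2013
    calc Real.log d * (1 - ρt) ≤ (2 * L ^ 9) * (K₅ * (L ^ 2022)⁻¹) :=
          mul_le_mul hlogd hρK' (by linarith only [hρ1]) (by positivity)
      _ ≤ 1 := by linarith only [h9]
  have hdPη : ((d : ℝ) / P4 D) ^ η ≤ 2 * Real.exp (-(6 * η * L ^ (1.1 : ℝ))) := by
    have hP4 : 0 < P4 D := by linarith only [hP1]
    have hT0 : 0 < bigT D := Real.exp_pos _
    have hratio : (d : ℝ) / P4 D ≤ 2 * (bigT D ^ 6)⁻¹ := by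
      rw [div_le_iff₀ hP4]
      have hT6 : 0 < bigT D ^ 6 := pow_pos hT0 6
      calc (d : ℝ) = (d : ℝ) * bigT D ^ 6 * (bigT D ^ 6)⁻¹ := by
            rw [mul_inv_cancel_right₀ hT6.ne']
        _ ≤ 2 * P4 D * (bigT D ^ 6)⁻¹ := by gcongr
        _ = 2 * (bigT D ^ 6)⁻¹ * P4 D := by ring
    have hd0 : 0 ≤ (d : ℝ) / P4 D := div_nonneg (Nat.cast_nonneg d) hP4.le
    have hT6 : (bigT D ^ 6)⁻¹ = Real.exp (-(6 * L ^ (1.1 : ℝ))) := by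
      rw [bigT, ← Real.exp_nat_mul, ← Real.exp_neg, hLdef]; push_cast; ring_nf
    calc ((d : ℝ) / P4 D) ^ η ≤ (2 * (bigT D ^ 6)⁻¹) ^ η := Real.rpow_le_rpow hd0 hratio hη0.le
      _ = 2 ^ η * ((bigT D ^ 6)⁻¹) ^ η := Real.mul_rpow (by norm_num) (by positivity)
      _ ≤ 2 * Real.exp (-(6 * η * L ^ (1.1 : ℝ))) := by
          have h2 : (2 : ℝ) ^ η ≤ 2 := by
            have := Real.rpow_le_rpow_of_exponent_le (by norm_num : (1 : ℝ) ≤ 2) hη1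
            rwa [Real.rpow_one] at this
          have h3 : ((bigT D ^ 6)⁻¹) ^ η = Real.exp (-(6 * η * L ^ (1.1 : ℝ))) := by
            rw [hT6, ← Real.exp_mul]; ring_nf
          rw [h3]
          exact mul_le_mul_of_nonneg_right h2 (Real.exp_pos _).le
  -- the Gaussian budget and the stretched exponential
  have hg0 : 0 ≤ GaussWeight.gauss (4 * L ^ 30)⁻¹ (H - |b2 c' D|) := (GaussWeight.gauss_pos _ _).le
  have hgb : L ^ 2600 * Real.exp (2 * L ^ 9 + 2) * GaussWeight.gauss (4 * L ^ 30)⁻¹ (H - |b2 c' D|) ≤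
      1 := by
    have hgle : GaussWeight.gauss (4 * L ^ 30)⁻¹ (H - |b2 c' D|) ≤
        Real.exp (-(L ^ 20 - 1) ^ 2 / (4 * L ^ 30)) := by
      rw [GaussWeight.gauss, abs_of_pos hb2]
      refine Real.exp_le_exp.mpr ?_
      have h20 : 1 ≤ L ^ 20 := one_le_pow₀ hL1
      have h1 : (L ^ 20 - 1) ^ 2 ≤ (H - b2 c' D) ^ 2 := by
        rw [hH]
        exact pow_le_pow_left₀ (by linarith only [h20]) (by linarith only [hb2']) 2
      rw [neg_div, neg_mul, neg_le_neg_iff, div_eq_inv_mul]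
      exact mul_le_mul_of_nonneg_left h1 (by positivity)
    have hb := hbudget L hLb
    have hL2600 : L ^ (2600 : ℝ) = L ^ 2600 := by norm_cast
    rw [hL2600] at hb
    exact le_trans (mul_le_mul_of_nonneg_left hgle (by positivity)) hb
  have hG' : L ^ (2020 : ℝ) ≤ Real.exp (3 * cL / 4 * L ^ (1 / 10 : ℝ)) := hG L hLg
  -- the local theorem and the numerics
  have hell1 : 1 ≤ ell D := by rw [← hLdef]; exact hL1
  have hloc := integral_u023_sub_residues_le_local c' χ d l hχ1 hd (E := Real.exp 1) hη0 hη20 hH2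
    hell1 hP1 hb1 hb1' hb2 hb2' hb12 hβ1n hM_diff hKM0 hM_bd hBζ0 hζpk hMinv0 hρ0 hρ1 hρη hLρ hL'ρ
    hLpk hζρ hL1ne hL2ne hE5
  rw [← hLdef] at hloc
  refine hloc.trans ?_
  have hWrw : C₂₂ * (48 / π +
      1 / (2 * π) * ((8 / cL + Cζ) * Cζ * (2 * (CL + 1)) * (1 + 16 / cL) * (24 / cL) * 8) +
      72 * (1 + Cζ) * Cζ * (CL + 1) / π + 2 * (CL + 1) * (2 / π + Cζ) * (2 * K₅) * 3 * (3 / π)) *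
      (∏ q ∈ (d * l).primeFactors, (1 + c₂₂ / (q : ℝ) ^ (9 / 10 : ℝ))) * (L ^ 2000)⁻¹ =
      KM * (48 / π +
      1 / (2 * π) * ((8 / cL + Cζ) * Cζ * (2 * (CL + 1)) * (1 + 16 / cL) * (24 / cL) * 8) +
      72 * (1 + Cζ) * Cζ * (CL + 1) / π + 2 * (CL + 1) * (2 / π + Cζ) * (2 * K₅) * 3 * (3 / π)) *
      (L ^ 2000)⁻¹ := by rw [hKM, hW]; ring
  rw [hWrw]
  exact numeric_bound_wide hL64 hη0 hη1 hηlow hcL hH hBζ0 hBζL hCζ hMinv0 hMinvL hCL hKM0 hρ1 hρK'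
    hK₅
    hb1π hb2π hb2' hP1 hP4le hd1r hdP hdPη hg0 hgb hG'

/-- **(16.10) at the integral level on the support of `b₁`** — the hypothesis `hI` of the tree's
`Typed.Section16A.eq16_10W_of_integral_bound_pow` with `k = 2000`: for all large `D`, (A), all
`d, l ≥ 1` with `dl < 2T²P^{1/2}max(P₂,P₃)`, the contour estimate with error
`C∏_{q∣dl}(1 + c₀/q^{9/10})𝓛⁻²⁰⁰⁰`. [cite: Zhang2022LandauSiegel, §16 (16.10)–(16.12) p.92] -/
theorem integral_u023_sub_residues_le_wide (h21 : Step16_u021an c') (h22 : Step16_u022 c') :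
    ∃ c₀ C : ℝ, ForAllLarge fun D _ χ => AssumptionA D χ →
      ∀ d l : ℕ, 1 ≤ d → 1 ≤ l →
        ((d * l : ℕ) : ℝ) < 2 * bigT D ^ 2 * (bigP D ^ (1 / 2 : ℝ) * max (Skeleton.P2 D) (P3 D)) →
        ‖(1 / (2 * π) : ℂ) * (∫ t : ℝ, integrand16_u023 c' χ d l (1 + t * I)) -
            ∑ j ∈ ({1, 2} : Finset ℕ),
              calR2 c' χ j * (d : ℂ) ^ betaJ c' D j * calM2 c' χ d l (1 - betaJ c' D j)‖ ≤
          C * (∏ q ∈ (d * l).primeFactors, (1 + c₀ / (q : ℝ) ^ (9 / 10 : ℝ))) * (ell D ^ 2000)⁻¹ := by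
  obtain ⟨c, C, D₁, h⟩ := integral_u023_sub_residues_le_core c' h21 h22
  refine ⟨c, C, max D₁ ⌈Real.exp 64⌉₊, fun D _ χ hD hq hp hA_ d l hd1 hl1 hdl => ?_⟩
  have hD₁ : D₁ ≤ D := le_trans (le_max_left _ _) hD
  have hL : 64 ≤ ell D := by
    have hD' : ⌈Real.exp 64⌉₊ ≤ D := le_trans (le_max_right _ _) hD
    have h1 : Real.exp 64 ≤ D := le_trans (Nat.le_ceil _) (by exact_mod_cast hD')
    exact (Real.le_log_iff_exp_le (lt_of_lt_of_le (Real.exp_pos _) h1)).mpr h1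
  have hdreal : (d : ℝ) ≤ ((d * l : ℕ) : ℝ) := by
    have : d ≤ d * l := Nat.le_mul_of_pos_right d (by omega)
    exact_mod_cast this
  obtain ⟨hdT, hd2P⟩ := range_facts_of_lt_support hL hdreal hdl
  exact h D χ hD₁ hq hp hA_ d l hd1 hl1 hdT hd2P

/-- **(16.12) from (16.5)ᴾ and the two `ℳ₂` displays.** `Σ₁ b₁(n)ξ₁₂(n)/n = 𝔔₂ + o(𝔭)`
(`Typed.Section16A.Eq16_12 c′`) follows from `Eq16_5P c′`, `Step16_u021an c′`, `Step16_u022 c′` by the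
tree's glue `Typed.Section16A.eq16_12_of_eq16_5P_of_integral_bound_pow` (§16.u023 discharged there)
and `integral_u023_sub_residues_le_wide`. [cite: Zhang2022LandauSiegel, §16 (16.12) p.92] -/
theorem eq16_12_of_eq16_5P (h5 : Eq16_5P c') (h21 : Step16_u021an c') (h22 : Step16_u022 c') :
    Eq16_12 c' :=
  eq16_12_of_eq16_5P_of_integral_bound_pow c' h5 2000 (by norm_num)
    (integral_u023_sub_residues_le_wide c' h21 h22)

end Main

end Literature.NumberTheory.LFunctions.Zhang2022.Eq1610
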